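import Summits.QuantumFields.QCD.Theses.NestedDissectionSea
import Literature.MathematicalPhysics.QuantumFieldTheory.SpectralDefectDensity

/-!
# Crux `CoerciveSea` (stmt-QuantumFields-13901), line `chirality-collapses-pseudospectrum` —
# engine lemmas for the hardest stub: the bare mass enters the Dirichlet cell additively, and a
# crossing of the cell at `μ⋆` is an EXACT `|μ − μ⋆|`-eigenvector (sojourn lemma) at every `μ`

Helper file of the line lead (supports `stub_chiralPileupRareOfPinned`; it is also finding B1's
"item 1", the Lean-provable half of the argument that fixed-level cell statistics under-resolve
physical cells). Content, for the Dirichlet cell matrix `D_c(μ) = wilsonCell U μ x s` of ANY box: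

* `wilsonCell_mass_eq_add_scalar` — `D_c(μ) = D_c(0) + μ·1` (compression of
  `wilsonDirac_mass_eq_add_scalar`), hence `wilsonCell_eq_add_scalar_sub` — `D_c(μ) = D_c(μ⋆) + (μ − μ⋆)·1`;
* `exists_eigenvector_of_det_wilsonCell_eq_zero` — if `det D_c(μ⋆) = 0` then a kernel vector `v ≠ 0`
  of `D_c(μ⋆)` satisfies `D_c(μ) v = (μ − μ⋆) v` for every `μ`;
* `cell_residual_lt_of_det_wilsonCell_eq_zero` — consequently the cell near-kernel event
  `∃ v ≠ 0, ‖D_c(μ) v‖² < τ² ‖v‖²` (the currency of `CoerciveSeaNegative.hasSingularSeparator_cell_residual_lt`)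
  holds at every level `τ > |μ − μ⋆|`: `σ_min(D_c(μ)) ≤ dist(μ, crossings)`.

Standard finite-dimensional linear algebra. [folklore]
-/

noncomputable section

open scoped BigOperators
open Matrix Literature.MathematicalPhysics.QuantumLattice Literature.MathematicalPhysics.QuantumFieldTheory
  Literature.Probability.LatticeModels

namespace Summit.QuantumFields.QCD.Theorems.NestedDissectionSeaCoerciveSea

variable {N : ℕ} [NeZero N]

/-- **The bare mass enters the Dirichlet cell additively**: `D_c(μ) = D_c(0) + μ·1` for the cell of
any corner `x` and sides `s` (the compression to the box of `wilsonDirac_mass_eq_add_scalar`: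
principal submatrices of a scalar matrix are scalar). [folklore] -/
theorem wilsonCell_mass_eq_add_scalar (U : GaugeConfig 4 N (Matrix.specialUnitaryGroup (Fin 3) ℂ))
    (μ : ℝ) (x : TorusSite 4 N) (s : Fin 4 → ℕ) :
    wilsonCell U μ x s = wilsonCell U 0 x s + Matrix.scalar _ (μ : ℂ) := by
  ext i j
  rw [wilsonCell, wilsonCell, wilsonDirac_mass_eq_add_scalar (fundamentalRep (Fin 3)) U μ 1,
    Matrix.add_apply, toSquareBlockProp_def, toSquareBlockProp_def, Matrix.of_apply, Matrix.of_apply,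
    Matrix.add_apply, Matrix.scalar_apply, Matrix.scalar_apply, Matrix.diagonal_apply,
    Matrix.diagonal_apply]
  by_cases h : i = j
  · subst h; simp
  · have h' : (i : TorusSite 4 N × Fin 3 × Fin 4) ≠ j := fun hij => h (Subtype.ext hij)
    simp [h, h']

/-- **Mass shift between two bare masses**: `D_c(μ) = D_c(μ⋆) + (μ − μ⋆)·1`. [folklore] -/
theorem wilsonCell_eq_add_scalar_sub (U : GaugeConfig 4 N (Matrix.specialUnitaryGroup (Fin 3) ℂ))
    (μ μs : ℝ) (x : TorusSite 4 N) (s : Fin 4 → ℕ) :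
    wilsonCell U μ x s = wilsonCell U μs x s + Matrix.scalar _ ((μ - μs : ℝ) : ℂ) := by
  rw [wilsonCell_mass_eq_add_scalar U μ, wilsonCell_mass_eq_add_scalar U μs, add_assoc,
    ← (Matrix.scalar _).map_add]
  congr 2
  push_cast
  ring

/-- **Sojourn lemma (a crossing is an exact pseudomode at every nearby mass).** If the Dirichlet
cell is singular at the bare mass `μ⋆` (`det D_c(μ⋆) = 0`: a real-eigenvalue CROSSING of the cell),
then a kernel vector `v ≠ 0` of `D_c(μ⋆)` is an eigenvector of `D_c(μ)` with eigenvalue `μ − μ⋆`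
for EVERY bare mass `μ` — the mass is a scalar shift. [folklore] -/
theorem exists_eigenvector_of_det_wilsonCell_eq_zero
    (U : GaugeConfig 4 N (Matrix.specialUnitaryGroup (Fin 3) ℂ)) {μs : ℝ} (x : TorusSite 4 N)
    (s : Fin 4 → ℕ) (h : (wilsonCell U μs x s).det = 0) (μ : ℝ) :
    ∃ v : {p // wilsonBox x s p} → ℂ, v ≠ 0 ∧
      (wilsonCell U μ x s).mulVec v = ((μ - μs : ℝ) : ℂ) • v := by
  obtain ⟨v, hv0, hv⟩ := Matrix.exists_mulVec_eq_zero_iff.mpr h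
  refine ⟨v, hv0, ?_⟩
  rw [wilsonCell_eq_add_scalar_sub U μ μs, Matrix.add_mulVec, hv, zero_add, Matrix.scalar_apply,
    ← Matrix.diagonal_const_mulVec]

/-- **`σ_min(D_c(μ)) ≤ dist(μ, crossings)`, in the residual currency of the crux.** If
`det D_c(μ⋆) = 0` then for every bare mass `μ` and every level `τ > |μ − μ⋆|` the cell near-kernel
event holds: some `v ≠ 0` on the box has `Σ_p ‖(D_c(μ) v)_p‖² < τ² Σ_p ‖v_p‖²` (indeed with
equality at level `|μ − μ⋆|`). This is the exact half of finding B1 (a physical lump whose cell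
crossing sits within `h` of the valence mass makes the cell `h`-pseudo-singular). [folklore] -/
theorem cell_residual_lt_of_det_wilsonCell_eq_zero
    (U : GaugeConfig 4 N (Matrix.specialUnitaryGroup (Fin 3) ℂ)) {μs : ℝ} (x : TorusSite 4 N)
    (s : Fin 4 → ℕ) (h : (wilsonCell U μs x s).det = 0) {μ τ : ℝ} (hτ : |μ - μs| < τ) :
    ∃ v : {p // wilsonBox x s p} → ℂ, v ≠ 0 ∧
      ∑ p, ‖(wilsonCell U μ x s).mulVec v p‖ ^ 2 < τ ^ 2 * ∑ p, ‖v p‖ ^ 2 := by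
  obtain ⟨v, hv0, hv⟩ := exists_eigenvector_of_det_wilsonCell_eq_zero U x s h μ
  refine ⟨v, hv0, ?_⟩
  have hsum : ∑ p, ‖(wilsonCell U μ x s).mulVec v p‖ ^ 2 = |μ - μs| ^ 2 * ∑ p, ‖v p‖ ^ 2 := by
    rw [hv, Finset.mul_sum]
    refine Finset.sum_congr rfl fun p _ => ?_
    rw [Pi.smul_apply, smul_eq_mul, norm_mul, Complex.norm_real, Real.norm_eq_abs, mul_pow]
  have hpos : 0 < ∑ p, ‖v p‖ ^ 2 := by
    obtain ⟨p, hp⟩ : ∃ p, v p ≠ 0 := by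
      by_contra hall
      push Not at hall
      exact hv0 (funext hall)
    exact Finset.sum_pos' (fun q _ => by positivity) ⟨p, Finset.mem_univ _, by positivity⟩
  rw [hsum]
  have habs : 0 ≤ |μ - μs| := abs_nonneg _
  have hlt : |μ - μs| ^ 2 < τ ^ 2 := by
    have hτ0 : 0 < τ := habs.trans_lt hτ
    nlinarith
  exact mul_lt_mul_of_pos_right hlt hpos

/-- **Registered sub-goal form of the sojourn lemma** (stub `sojourn_cell_residual_lt` of crux
stmt-QuantumFields-13901, line `chirality-collapses-pseudospectrum`): a crossing of the Dirichlet cell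
at `μ⋆` makes the cell near-kernel event hold at every bare mass `μ` and every level `τ > |μ − μ⋆|`.
[folklore] -/
theorem sojourn_cell_residual_lt :
    ∀ (N : ℕ) [NeZero N] (U : GaugeConfig 4 N (Matrix.specialUnitaryGroup (Fin 3) ℂ)) (μs : ℝ)
      (x : TorusSite 4 N) (s : Fin 4 → ℕ), (wilsonCell U μs x s).det = 0 → ∀ (μ τ : ℝ), |μ - μs| < τ →
      ∃ v : {p // wilsonBox x s p} → ℂ, v ≠ 0 ∧
        ∑ p, ‖(wilsonCell U μ x s).mulVec v p‖ ^ 2 < τ ^ 2 * ∑ p, ‖v p‖ ^ 2 :=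
  fun _ _ U _ x s h _ _ hτ => cell_residual_lt_of_det_wilsonCell_eq_zero U x s h hτ

end Summit.QuantumFields.QCD.Theorems.NestedDissectionSeaCoerciveSea

end
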